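import Mathlib
import HarnessLib
import Summits.NavierStokesRegularity.NavierStokesRegularity.Theorems.ChiralWindowDoorDefs
import Summits.NavierStokesRegularity.NavierStokesRegularity.Theorems.ChiralWindowDoorEnergyLedger
import Summits.NavierStokesRegularity.NavierStokesRegularity.Theorems.ClockStretchingLawClockCeilingLocalL3BlowupSingular
import Summits.NavierStokesRegularity.NavierStokesRegularity.Theorems.PoloidalWindowDoorPoloidalWindowRigidityWindow

/-!
# Door S20 «ChiralWindowDoor» — stub B5b `stub_essLocalClass` PROVED: ESS in the door class

Door S20 of nsreg-p1's local Type-I door family (`HOME/ns-regularity-ideate-p1/r19/ROUND-19-DRAFT.md`, line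
`r19/Sketch20v5.lean` 7f13084196f4f031; DESIGN-ONLY, route NOT born).  The residue line of its profile crux K2
(R19-LINE B0–B5) ends with two bookkeeping stubs: B5a (`stub_sobolevFatou`: a uniform bound on the localised
Gagliardo forms of the slices ⇒ the slices are bounded in `L³(B₁)`) and **B5b (`stub_essLocalClass`): a door-class
profile whose slices are bounded in `L³(B₁)` uniformly on `(−1,0)` is not backward-singular at the apex.**

* `essLocalClass` — **stub B5b of `r19/Sketch20v5.lean` (text verbatim over the tree substrate
  `…Theorems.ChiralWindowDoorDefs`), PROVED**: the door class is the Type-I ancient mild class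
  (`isTypeIAncientMild_of_class`) with the Albritton–Barker energy ledger
  (`…ChiralWindowDoorEnergyLedger.energyLedger_of_decay`, from the space–time decay and the binder's gradient
  conjunct), so the tree's unit-scale contrapositive of ESS 2003 Thm 1.4 (`…Theorems.localL3BlowupSingular_unit`:
  suitable weak solution with the mean-free classical pressure in `Q(0,1)` via `classPressure_holds`,
  `ess_local_holder_holds`, Hölder representative on `Q(0,½)`, boundedness by continuity) refutes backward
  singularity at the apex;
* `essLocalClass_of_gradDecay` — the same with the binder reduced to its gradient conjunct (which
  `…ChiralWindowDoorClassDerivDecay.derivDecay_of_class` supplies for EVERY door-class profile, so downstream the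
  binder disappears).

Seat nsreg-p6 g11 (THEOREMS-ONLY door sequels, DIRECTOR-NS g8 #32 (2)/#36).  WHAT THIS IS NOT: not NS regularity
(Clay A); not K2 `ChiralProfileRigidity` — one bookkeeping stub of its residue line (B1′, B2′, B3, B5a and the spread
stub remain OPEN by design); no route is opened.
-/

noncomputable section

-- the summit and its single sub-problem share the name (CONVENTIONS §1), as in every Theorems file
set_option linter.dupNamespace false

namespace Summit.NavierStokesRegularity.NavierStokesRegularity.Theorems.ChiralWindowDoorEssLocalClass

open MeasureTheory Set Function Filter Topology Metric
open scoped NNReal ENNReal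
open Literature.Analysis Literature.Analysis.FluidPDE
open Summit.NavierStokesRegularity.NavierStokesRegularity.Theorems.ChiralWindowDoorDefs
open Summit.NavierStokesRegularity.NavierStokesRegularity.Theorems.ChiralWindowDoorEnergyLedger
open Summit.NavierStokesRegularity.NavierStokesRegularity.Theorems.PoloidalWindowDoorPoloidalWindowRigidityWindow
  (isTypeIAncientMild_of_class)


/-- **Stub B5b `stub_essLocalClass` of nsreg-p1 `r19/Sketch20v5.lean` (text verbatim), PROVED — ESS IN THE DOOR
CLASS.**  A door-class profile (Type-I time rate, Type-I space–time decay, the derivative binder, continuity on the open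
backward slab, unit-viscosity Oseen–Duhamel identity, divergence-free slices) whose slices are bounded in `L³(B₁)`
uniformly on `(−1,0)` is not backward-singular at the apex: the class is the Type-I ancient mild class
(`isTypeIAncientMild_of_class`) with the Albritton–Barker energy ledger (`energyLedger_of_decay`), so the tree's
unit-scale contrapositive of ESS 2003 Thm 1.4 (`…Theorems.localL3BlowupSingular_unit`: suitable weak solution with
the mean-free classical pressure in `Q(0,1)`, `ess_local_holder_holds`, Hölder representative on `Q(0,½)`,
boundedness by continuity) applies. -/
theorem essLocalClass : ∀ (C D K : ℝ) (v : ℝ → EuclideanSpace ℝ (Fin 3) → EuclideanSpace ℝ (Fin 3)),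
    HasTypeITimeDecay C v → HasTypeIDecay D v → HasTypeIDerivDecay K v →
    ContinuousOn (Function.uncurry v) (Set.Iio (0 : ℝ) ×ˢ Set.univ) →
    (∀ s t : ℝ, s < t → t < 0 → ∀ x,
        v t x = UnboundedOperators.heatExtension (v s) (t - s) x - oseenDuhamel 1 s v v t x) →
    (∀ t < 0, VectorCalculus.IsDivFree (v t)) →
    (∃ M : NNReal, ∀ t ∈ Set.Ioo (-1 : ℝ) 0,
      ∫⁻ x in Metric.ball (0 : EuclideanSpace ℝ (Fin 3)) 1, ‖v t x‖ₑ ^ (3 : ℕ) ≤ M) →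
    ¬ IsBackwardSingularPoint v 0 := by
  intro C D K v hrate hdecay hder hcont hmild hdiv hL3 hsing
  obtain ⟨M, hM⟩ := hL3
  set L : ℝ := 9 * (volume : Measure (EuclideanSpace ℝ (Fin 3))).real (ball 0 1) * D ^ 2 +
    8 * (volume : Measure (EuclideanSpace ℝ (Fin 3))).real (ball 0 1) * K ^ 2 with hL
  have hled := energyLedger_of_decay hdecay (fun t ht x => (hder t ht x).1)
  have hK0 : IsTypeIAncientMild C v := isTypeIAncientMild_of_class hrate hcont hmild hdiv
  -- class inclusion `C ≤ max C L` (only the Type-I rate depends on the constant)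
  have hK : IsTypeIAncientMild (max C L) v :=
    ⟨hK0.1, hK0.2.1, hK0.2.2.1, fun t ht x =>
      (hK0.2.2.2 t ht x).trans (div_le_div_of_nonneg_right (le_max_left _ _) (Real.sqrt_nonneg _))⟩
  have h5 : ∀ (x₀ : EuclideanSpace ℝ (Fin 3)) (t₀ r : ℝ), t₀ ≤ 0 → 0 < r →
      (∀ t, t₀ - r ^ 2 < t → t < t₀ → r⁻¹ * ∫ x in Metric.ball x₀ r, ‖v t x‖ ^ 2 ≤ max C L) ∧
        r⁻¹ * ∫ t in Set.Ioo (t₀ - r ^ 2) t₀, ∫ x in Metric.ball x₀ r, ‖fderiv ℝ (v t) x‖ ^ 2 ≤ max C L := by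
    intro x₀ t₀ r ht₀ hr
    obtain ⟨hA, hE⟩ := hled x₀ t₀ r ht₀ hr
    exact ⟨fun t h1 h2 => (hA t h1 h2).trans (le_max_right _ _), hE.trans (le_max_right _ _)⟩
  have hM' : ∀ t ∈ Set.Ioo (-1 : ℝ) 0,
      ∫⁻ x in Metric.ball (0 : EuclideanSpace ℝ (Fin 3)) 1, ‖v t x‖ₑ ^ 3 ≤ M := fun t ht => hM t ht
  exact localL3BlowupSingular_unit hK h5 (exists_large_of_isBackwardSingularPoint hsing) hM'

/-- **B5b with the binder discharged to its gradient conjunct**: the same conclusion for a door-class profile given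
only the gradient decay `(‖x‖+√(−t))²‖∇v‖ ≤ K` (which `…ChiralWindowDoorClassDerivDecay.derivDecay_of_class`
produces for EVERY door-class profile, so that downstream the binder disappears). -/
theorem essLocalClass_of_gradDecay {C D K : ℝ} {v : ℝ → EuclideanSpace ℝ (Fin 3) → EuclideanSpace ℝ (Fin 3)}
    (hrate : HasTypeITimeDecay C v) (hdecay : HasTypeIDecay D v)
    (hgrad : ∀ t < (0 : ℝ), ∀ x : EuclideanSpace ℝ (Fin 3),
      (‖x‖ + Real.sqrt (-t)) ^ 2 * ‖fderiv ℝ (v t) x‖ ≤ K)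
    (hcont : ContinuousOn (Function.uncurry v) (Set.Iio (0 : ℝ) ×ˢ Set.univ))
    (hmild : ∀ s t : ℝ, s < t → t < 0 → ∀ x,
        v t x = UnboundedOperators.heatExtension (v s) (t - s) x - oseenDuhamel 1 s v v t x)
    (hdiv : ∀ t < 0, VectorCalculus.IsDivFree (v t))
    {M : NNReal} (hM : ∀ t ∈ Set.Ioo (-1 : ℝ) 0,
      ∫⁻ x in Metric.ball (0 : EuclideanSpace ℝ (Fin 3)) 1, ‖v t x‖ₑ ^ (3 : ℕ) ≤ M) :
    ¬ IsBackwardSingularPoint v 0 := by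
  intro hsing
  set L : ℝ := 9 * (volume : Measure (EuclideanSpace ℝ (Fin 3))).real (ball 0 1) * D ^ 2 +
    8 * (volume : Measure (EuclideanSpace ℝ (Fin 3))).real (ball 0 1) * K ^ 2 with hL
  have hled := energyLedger_of_decay hdecay hgrad
  have hK0 : IsTypeIAncientMild C v := isTypeIAncientMild_of_class hrate hcont hmild hdiv
  -- class inclusion `C ≤ max C L` (only the Type-I rate depends on the constant)
  have hK : IsTypeIAncientMild (max C L) v :=
    ⟨hK0.1, hK0.2.1, hK0.2.2.1, fun t ht x =>
      (hK0.2.2.2 t ht x).trans (div_le_div_of_nonneg_right (le_max_left _ _) (Real.sqrt_nonneg _))⟩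
  have h5 : ∀ (x₀ : EuclideanSpace ℝ (Fin 3)) (t₀ r : ℝ), t₀ ≤ 0 → 0 < r →
      (∀ t, t₀ - r ^ 2 < t → t < t₀ → r⁻¹ * ∫ x in Metric.ball x₀ r, ‖v t x‖ ^ 2 ≤ max C L) ∧
        r⁻¹ * ∫ t in Set.Ioo (t₀ - r ^ 2) t₀, ∫ x in Metric.ball x₀ r, ‖fderiv ℝ (v t) x‖ ^ 2 ≤ max C L := by
    intro x₀ t₀ r ht₀ hr
    obtain ⟨hA, hE⟩ := hled x₀ t₀ r ht₀ hr
    exact ⟨fun t h1 h2 => (hA t h1 h2).trans (le_max_right _ _), hE.trans (le_max_right _ _)⟩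
  have hM' : ∀ t ∈ Set.Ioo (-1 : ℝ) 0,
      ∫⁻ x in Metric.ball (0 : EuclideanSpace ℝ (Fin 3)) 1, ‖v t x‖ₑ ^ 3 ≤ M := fun t ht => hM t ht
  exact localL3BlowupSingular_unit hK h5 (exists_large_of_isBackwardSingularPoint hsing) hM'

end Summit.NavierStokesRegularity.NavierStokesRegularity.Theorems.ChiralWindowDoorEssLocalClass
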